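import Literature.NumberTheory.QuadraticFields.ThreeTorsionMeanProofs
import HarnessLib

/-!
# Squarefree integers mod `4` and fundamental discriminants: the densities as limits

Limit forms of the explicit counts PROVED in `ThreeTorsionMeanProofs.lean`
(`abs_card_squarefree_mod_four_sub_le`: `|#{n ≤ N : n squarefree, n ≡ a (4)} − (2/π²) N| ≤ 3 √N`
for `a ∈ {1, 2, 3}`; `abs_card_posFundDiscrs_sub_le`, `abs_card_negFundDiscrs_sub_le`:
`|#{0 < ±D < X fundamental} − (3/π²) X| ≤ 8 √X`), in the shape in which Bhargava–Shankar–Tsimerman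
quote them in the proof of the Davenport–Heilbronn mean values (§8.5, p. 20 of arXiv:1005.0672:
"Since it is known that `lim_{X→∞} Σ_{0<Disc(K₂)<X} 1 / X = 3/π²` and
`lim_{X→∞} Σ_{-X<Disc(K₂)<0} 1 / X = 3/π²`, we conclude …"):

* `tendsto_div_of_abs_sub_le_sqrt` — `|N(X) − d X| ≤ C √X` for all `X` gives `N(X)/X → d`;
* `tendsto_card_squarefree_mod_four_div` — `#{n ≤ N : n squarefree, n ≡ a (mod 4)} / N → 2/π²`
  (`a = 1, 2, 3`: the squarefree integers are equidistributed in the three admissible classes);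
* `tendsto_card_posFundDiscrs_div`, `tendsto_card_negFundDiscrs_div` —
  **`#posFundDiscrs X / X → 3/π²`, `#negFundDiscrs X / X → 3/π²`**: the number of real
  (resp. imaginary) quadratic fields with `|D| < X` is `~ (3/π²) X`;

The conjunction of the last two is the named fact `fundDiscrs_card_asymp` of `ThreeTorsionMean.lean`
(the input "it is known that …" of the printed proof of BST Cor. 7); its discharge
`fundDiscrs_card_asymp_holds` now lives in `ThreeTorsionMeanProofs.lean` (imported here), so this
module no longer re-declares it — `fundDiscrs_card_asymp_holds'` below records that the two limit
theorems of this file give the same conjunction.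

Theorems only (no definition, no named fact). An earlier revision of this module re-derived the
squarefree counts from scratch; they are now taken from `ThreeTorsionMeanProofs.lean`, which landed
first, and only the limit statements are kept here.

## References

* M. Bhargava, A. Shankar, J. Tsimerman, *On the Davenport–Heilbronn theorems and second order
  terms*, Invent. Math. 193 (2013) 439–499 = arXiv:1005.0672, §8.5 [BhargavaShankarTsimerman2012].
* M. Bhargava, T. Taniguchi, F. Thorne, *Improved error estimates for the Davenport–Heilbronn
  theorems*, Math. Ann. 389 (2024), Prop. 4.2 [BhargavaTaniguchiThorne2023].
-/

noncomputable section

open Finset Filter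
open scoped Topology

namespace Literature.NumberTheory.QuadraticFields

/-- **From a square-root error term to a density**: if `|N(X) − d X| ≤ C √X` for every `X : ℕ`
then `N(X)/X → d` (indeed `|N(X)/X − d| ≤ C/√X`). [folklore] -/
theorem tendsto_div_of_abs_sub_le_sqrt {N : ℕ → ℝ} {d C : ℝ}
    (hN : ∀ X : ℕ, |N X - d * X| ≤ C * Real.sqrt X) :
    Tendsto (fun X : ℕ => N X / X) atTop (𝓝 d) := by
  have h0 : Tendsto (fun X : ℕ => C / Real.sqrt X) atTop (𝓝 0) :=
    tendsto_const_nhds.div_atTop (Real.tendsto_sqrt_atTop.comp tendsto_natCast_atTop_atTop)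
  have hE : Tendsto (fun X : ℕ => N X / X - d) atTop (𝓝 0) := by
    refine squeeze_zero_norm' ?_ h0
    filter_upwards [eventually_ge_atTop 1] with X hX
    have hX0 : (0 : ℝ) < X := Nat.cast_pos.2 (by omega)
    have hX0' : (X : ℝ) ≠ 0 := hX0.ne'
    have hs : 0 < Real.sqrt X := Real.sqrt_pos.2 hX0
    rw [Real.norm_eq_abs, show N X / X - d = (N X - d * X) / X by field_simp, abs_div,
      abs_of_pos hX0, div_le_div_iff₀ hX0 hs]
    calc |N X - d * X| * Real.sqrt X ≤ C * Real.sqrt X * Real.sqrt X :=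
          mul_le_mul_of_nonneg_right (hN X) hs.le
      _ = C * X := by rw [mul_assoc, Real.mul_self_sqrt hX0.le]
  simpa using hE.add_const d

/-- **Squarefree integers are equidistributed among the classes `1, 2, 3 (mod 4)`, with density
`2/π²` each**: for `a ∈ {1, 2, 3}`, `#{1 ≤ n ≤ N : n squarefree, n ≡ a (mod 4)} / N → 2/π²`
(limit form of `abs_card_squarefree_mod_four_sub_le`). [folklore] -/
theorem tendsto_card_squarefree_mod_four_div {a : ℕ} (ha0 : a ≠ 0) (ha4 : a < 4) :
    Tendsto (fun N : ℕ =>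
      ((((Ioc 0 N).filter (fun n => Squarefree n ∧ n % 4 = a)).card : ℕ) : ℝ) / N)
      atTop (𝓝 (2 / Real.pi ^ 2)) :=
  tendsto_div_of_abs_sub_le_sqrt fun N => abs_card_squarefree_mod_four_sub_le ha0 ha4 N

/-- **The number of real quadratic fields of discriminant `< X` is `~ (3/π²) X`**
(Bhargava–Shankar–Tsimerman §8.5: "it is known that `lim_{X→∞} Σ_{0<Disc(K₂)<X} 1 / X = 3/π²`";
limit form of `abs_card_posFundDiscrs_sub_le`): `#posFundDiscrs X / X → 3/π²`.
[cite: BhargavaShankarTsimerman2012, §8.5] -/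
theorem tendsto_card_posFundDiscrs_div :
    Tendsto (fun X : ℕ => ((posFundDiscrs X).card : ℝ) / X) atTop (𝓝 (3 / Real.pi ^ 2)) :=
  tendsto_div_of_abs_sub_le_sqrt fun X => abs_card_posFundDiscrs_sub_le X

/-- **The number of imaginary quadratic fields of discriminant `> -X` is `~ (3/π²) X`**
(Bhargava–Shankar–Tsimerman §8.5: "it is known that `lim_{X→∞} Σ_{-X<Disc(K₂)<0} 1 / X = 3/π²`";
limit form of `abs_card_negFundDiscrs_sub_le`): `#negFundDiscrs X / X → 3/π²`.
[cite: BhargavaShankarTsimerman2012, §8.5] -/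
theorem tendsto_card_negFundDiscrs_div :
    Tendsto (fun X : ℕ => ((negFundDiscrs X).card : ℝ) / X) atTop (𝓝 (3 / Real.pi ^ 2)) :=
  tendsto_div_of_abs_sub_le_sqrt fun X => abs_card_negFundDiscrs_sub_le X

/-! ### The named fact `fundDiscrs_card_asymp` (`ThreeTorsionMean.lean`) from the two limits -/

/-- **`fundDiscrs_card_asymp` from the two limit theorems of this file** — the count of quadratic
fields quoted by Bhargava–Shankar–Tsimerman in the proof of Cor. 7 (§8.5, p. 20 of
arXiv:1005.0672, display "Since it is known that `lim_{X→∞} Σ_{0<Disc(K₂)<X} 1 / X = 3/π²`,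
`lim_{X→∞} Σ_{-X<Disc(K₂)<0} 1 / X = 3/π²`"): both halves are the theorems
`tendsto_card_negFundDiscrs_div` and `tendsto_card_posFundDiscrs_div` above. The DISCHARGE proper,
`fundDiscrs_card_asymp_holds`, is the theorem of the same name in `ThreeTorsionMeanProofs.lean`
(imported); this primed variant is kept only as the in-file cross-check and is definitionally the
same proposition.
[cite: BhargavaShankarTsimerman2012, §8.5 (proof of Cor. 7, display "Since it is known that")] -/
theorem fundDiscrs_card_asymp_holds' : fundDiscrs_card_asymp :=
  ⟨tendsto_card_negFundDiscrs_div, tendsto_card_posFundDiscrs_div⟩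

example : fundDiscrs_card_asymp := fundDiscrs_card_asymp_holds

end Literature.NumberTheory.QuadraticFields

end
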